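import Summits.HubbardSuperconductivity.HubbardSuperconductivity.Theorems.BalabanIRBirComplexStableXYRStubFatGaussianDomination
import Summits.HubbardSuperconductivity.HubbardSuperconductivity.Theorems.BalabanIRBirComplexStableXYRStubSubGaussianMargin
import Summits.HubbardSuperconductivity.HubbardSuperconductivity.Theorems.BalabanIRBirComplexStableXYRStubLargeFieldRegulated
import HarnessLib

/-!
# Crux `BirComplexStableXYR` (stmt-HubbardSuperconductivity-14845), line `fat-gaussian-defect-calculus`:
# stub R11 `stub_locFactorBounds` — modulus of the local factors `R_s(u) = exp(−K·genF c u + (K/2)·Q u)`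

Helper (`--supports`) for the crux
`Summit.HubbardSuperconductivity.HubbardSuperconductivity.Theses.BalabanIR.BirComplexStableXYR`, line
`fat-gaussian-defect-calculus` (lead skeleton `Cruxes/BirComplexStableXYR/Lines/fat_gaussian_defect_calculus.lean`),
registered stub R11 `stub_locFactorBounds` (chapter 1, wave 4): the chapter-2 interface.

Chapter 1 writes the Gibbs factor of each window as (thin Gaussian) × (local factor)
`R(u) = exp(−K·genF c u + (K/2)·Q u)`, where `Q u = Re(−Σ_n c_n (n·u)²)` is twice the real window Hessian
(pinned by the defining hypothesis `hQ`).  This file restates the three LANDED scale-0 modulus bounds for `R`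
instead of `e^{−KF}`:

* (i) fat-Gaussian domination (S2, `FatGaussian.stub_fatGaussianDomination`): always
  `‖R(u)‖ ≤ exp((K/2)Q u − (2c₀K/π²)·ΣΣ pv(u_w − u_w')²)`;
* (ii) sub-Gaussian margin (S3, `FatGaussian.stub_subGaussianMargin`): on windows of oscillation `≤ π`,
  `‖R(u)‖ ≤ exp((1 − 2ε₀)(K/2)·Q u)`, `ε₀ = 2c₀r³/(π²B)`;
* (iii) large-field smallness (S7, `FatGaussian.stub_largeFieldRegulated`): on windows of oscillation in `[p, π]`,
  `‖R(u)‖ ≤ exp((1 − ε₀)(K/2)·Q u)·exp(−ε₀c₀Kp²)`.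

**Proof.** `‖exp(z + t)‖ = ‖exp z‖·eᵗ` for real `t` (`Complex.exp_add`, `Complex.norm_exp_ofReal`), so each bound is
the corresponding landed bound multiplied by `e^{(K/2)Q u}`; the exponents are compared with `ring`. [folklore]

No definitions; sorry-free; everything else is Mathlib.
-/

set_option linter.dupNamespace false -- `Summit.<S>.<S>.Theorems…` repeats the summit name (D-0017 layout)

noncomputable section

namespace Summit.HubbardSuperconductivity.HubbardSuperconductivity.Theorems.FSUnfolding

open scoped BigOperators
open Literature.Probability.LatticeModels Summit.HubbardSuperconductivity.BirComplexStableXYNegative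

/-- Shifting the exponent by a real number multiplies the modulus by its real exponential:
`‖exp(z + t)‖ = ‖exp z‖ · eᵗ`. [folklore] -/
theorem locFactor_norm_exp_add_ofReal (z : ℂ) (t : ℝ) :
    ‖Complex.exp (z + (t : ℂ))‖ = ‖Complex.exp z‖ * Real.exp t := by
  rw [Complex.exp_add, norm_mul, Complex.norm_exp_ofReal]

/-- Transport of a modulus bound through a real shift of the exponent: if `‖exp z‖ ≤ exp a` then
`‖exp(z + t)‖ ≤ exp(a + t)`. [folklore] -/
theorem locFactor_norm_exp_add_ofReal_le {z : ℂ} {a : ℝ} (t : ℝ) (h : ‖Complex.exp z‖ ≤ Real.exp a) :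
    ‖Complex.exp (z + (t : ℂ))‖ ≤ Real.exp (a + t) := by
  rw [locFactor_norm_exp_add_ofReal, Real.exp_add]
  exact mul_le_mul_of_nonneg_right h (Real.exp_pos t).le

/-- **Registered stub R11 `stub_locFactorBounds` (verbatim signature): modulus of the local factors
`R(u) = exp(−K·genF c u + (K/2)·Q u)` — the chapter-2 interface.**
(i) fat-Gaussian domination (S2): always `‖R(u)‖ ≤ exp((K/2)Q u − (2c₀K/π²)·ΣΣ pv(u_w − u_w')²)`;
(ii) sub-Gaussian margin (S3): on windows of oscillation `≤ π`, `‖R(u)‖ ≤ exp((1 − 2ε₀)(K/2)·Q u)`,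
`ε₀ = 2c₀r³/(π²B)`; (iii) large-field smallness (S7): on windows of oscillation in `[p, π]`,
`‖R(u)‖ ≤ exp((1 − ε₀)(K/2)·Q u)·exp(−ε₀c₀Kp²)`.  (`‖e^{z+t}‖ = ‖e^z‖·eᵗ` and the landed S2/S3/S7.) [folklore] -/
theorem stub_locFactorBounds :
    ∀ (r : ℕ) (B c₀ K : ℝ) (c : Table r), 0 < B → 0 < c₀ → 0 ≤ K → (∀ n ∈ c.support, ∑ w, n w = 0) →
      c.sum (fun _ a => a) = 0 → normA c ≤ B →
      (∀ φ : W r → ℝ, c₀ * ∑ w, ∑ w', (1 - Real.cos (φ w - φ w')) ≤ (genF c φ).re) →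
      ∀ (Q : (W r → ℝ) → ℝ),
      (∀ u : W r → ℝ, Q u = (-c.sum (fun n a => a * (((∑ w, (n w : ℝ) * u w) ^ 2 : ℝ) : ℂ))).re) →
      ∀ u : W r → ℝ,
        ‖Complex.exp (-((K : ℂ) * genF c u) + (((K / 2 * Q u) : ℝ) : ℂ))‖ ≤
            Real.exp (K / 2 * Q u - (2 * c₀ * K / Real.pi ^ 2) *
              ∑ w, ∑ w', (toIocMod Real.two_pi_pos (-Real.pi) (u w - u w')) ^ 2) ∧
        ((∀ w w' : W r, |u w - u w'| ≤ Real.pi) →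
          ‖Complex.exp (-((K : ℂ) * genF c u) + (((K / 2 * Q u) : ℝ) : ℂ))‖ ≤
            Real.exp ((1 - 2 * (2 * c₀ * (r : ℝ) ^ 3 / (Real.pi ^ 2 * B))) * (K / 2) * Q u)) ∧
        (∀ p : ℝ, 0 ≤ p → (∀ w w' : W r, |u w - u w'| ≤ Real.pi) → (∃ w w' : W r, p ≤ |u w - u w'|) →
          ‖Complex.exp (-((K : ℂ) * genF c u) + (((K / 2 * Q u) : ℝ) : ℂ))‖ ≤
            Real.exp ((1 - 2 * c₀ * (r : ℝ) ^ 3 / (Real.pi ^ 2 * B)) * (K / 2) * Q u) *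
              Real.exp (-(2 * c₀ * (r : ℝ) ^ 3 / (Real.pi ^ 2 * B) * c₀ * K * p ^ 2))) := by
  intro r B c₀ K c hB hc₀ hK hU1 hN hA hC Q hQ u
  refine ⟨?_, ?_, ?_⟩
  · -- (i) fat-Gaussian domination: the landed S2 times `e^{(K/2)Q u}`
    have h1 := FatGaussian.stub_fatGaussianDomination r c₀ K c hc₀.le hK hC u
    refine (locFactor_norm_exp_add_ofReal_le (K / 2 * Q u) h1).trans_eq ?_
    congr 1
    ring
  · -- (ii) sub-Gaussian margin: the landed S3 (with `Qexpr = Q u` by `hQ`) times `e^{(K/2)Q u}`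
    intro hosc
    have h2 : ‖Complex.exp (-((K : ℂ) * genF c u))‖ ≤
        Real.exp (-(2 * c₀ * (r : ℝ) ^ 3 / (Real.pi ^ 2 * B)) * K * Q u) := by
      rw [hQ u]
      exact FatGaussian.stub_subGaussianMargin r B c₀ K c hB hc₀.le hK hU1 hA hC u hosc
    refine (locFactor_norm_exp_add_ofReal_le (K / 2 * Q u) h2).trans_eq ?_
    congr 1
    ring
  · -- (iii) large-field smallness: the landed S7 (with `Qexpr = Q u` by `hQ`) times `e^{(K/2)Q u}`
    intro p hp hosc hex
    have h3 : ‖Complex.exp (-((K : ℂ) * genF c u))‖ ≤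
        Real.exp (-(K / 2) * Q u) *
          Real.exp ((1 - 2 * c₀ * (r : ℝ) ^ 3 / (Real.pi ^ 2 * B)) * (K / 2) * Q u) *
          Real.exp (-(2 * c₀ * (r : ℝ) ^ 3 / (Real.pi ^ 2 * B) * c₀ * K * p ^ 2)) := by
      rw [hQ u]
      exact FatGaussian.stub_largeFieldRegulated r B c₀ K p c hB hc₀ hK hp hU1 hN hA hC u hosc hex
    rw [← Real.exp_add, ← Real.exp_add] at h3
    rw [← Real.exp_add]
    refine (locFactor_norm_exp_add_ofReal_le (K / 2 * Q u) h3).trans_eq ?_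
    congr 1
    ring

end Summit.HubbardSuperconductivity.HubbardSuperconductivity.Theorems.FSUnfolding

end
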